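import Summits.Ventures.Crystal3D.Theorems.StickyWulffConstantCoaxialWallLawPayerTwinCellMulti
import Summits.Ventures.Crystal3D.Theorems.StickyWulffConstantCoaxialWallLawPayerTransMulti
import Summits.Ventures.Crystal3D.Theorems.StickyWulffConstantCoaxialWallLawGrainLedgerRimLocal
import Summits.Ventures.Crystal3D.Theorems.StickyWulffConstantCoaxialWallLawInPlaneSlotSharp
import Summits.Ventures.Crystal3D.Theorems.StickyWulffConstantCoaxialWallLawTerracePropagation
import Summits.Ventures.Crystal3D.Theorems.StickyWulffConstantCoaxialWallLawInteriorLedger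
import Summits.Ventures.Crystal3D.Theorems.StickyWulffConstantCoaxialWallLawHaggConst
import Summits.Ventures.Crystal3D.Theorems.StickyWulffConstantGenericWallFloorCoaxialIff
import Summits.Ventures.Crystal3D.Theorems.StickyWulffConstantGenericWallFloorSampleDeficitUpper
import Summits.Ventures.Crystal3D.Theorems.StickyWulffConstantGenericWallFloorRigidRung
import Summits.Ventures.Crystal3D.Theorems.StickyWulffConstantNoReconstructionGainLatticeAdhesion
import HarnessLib

/-!
# End accounting, census-free, multi-source VI: the twin law sourced from ALL rising in-plane slots — constant √6/156

HONEST FRAMING. Part of the venture `Summits/Ventures/Crystal3D` (cell `crystal3d-full`), helper for the crux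
`CoaxialWallLaw` (stmt-Ventures-19481) of `route-Ventures-StickyWulffConstant`, REGISTERED line `WallLedgerF`
(planner cf-p1), open stub `stub_coaxialTwoSlabAdhesion` (general fillings).  Rung credit only; F-C1 not moved.
Brick (B5b) of memo HOME/wall-19481-p2/F-MULTISOURCE.md (19481-p2 g4): the text of 19481-p1's
`coaxialTwoSlabAdhesion_general_twin_censusFree` (`…PayerTwin`, constant `√6/312`, the sharp in-plane slot only) with the
multi-root twin cell `wordNet_twin_payers_ge_multi` (`…PayerTwinCellMulti`): the THREE rising in-plane slot classes
`±L u₁, ±L u₂, ±L (u₂ − u₁)` carry together `|x₁| + |x₂| + |x₂ − x₁| ≥ √3·sin θ` (`x = ⟪L ·, e₃⟫`; the sharp one alone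
carries `(√3/2)·sin θ`), so the flux doubles and the census-free twin constant becomes `√6/156 ≈ 1.57·10⁻²`.

* `sum_inPlane_rising_ge` — `√3·√(1 − ⟪L e₃, e₃⟫²) ≤ Σ_{r in-plane rising} (F r)₂` for a normal-form frame `F ∈ {L, R∘L}`.
* **`coaxialTwoSlabAdhesion_general_twin_multi`** — the stub's inequality for EVERY twin pair, arbitrary fillings,
  constant `√6/156`, modulo `KissingGap δ`, `KissingClassification δ` ONLY (×2 over `√6/312`; one plate — the mirror
  families of the top plate double it again, next brick).

WHAT THIS IS NOT: not the stub (`√6/156 < ½`); F-C1 not moved.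
-/
noncomputable section

namespace Summit.Ventures.Crystal3D.Theorems

open Summit.Ventures.Crystal3D Finset
open Literature.MathematicalPhysics.StatisticalMechanics (fccStacking barlowStacking IsHaggSeq
  contactDeficiency)
open scoped InnerProductSpace

/-- For reals `p, q`: `(|p| + |p + q|/2 + |q − p|/2)² ≥ 3p² + q²` — the three in-plane classes at `60°` carry
together at least `√3` times the tilt. -/
theorem three_sq_add_sq_le_sum_sq (p q : ℝ) :
    3 * p ^ 2 + q ^ 2 ≤ (|p| + |(p + q) / 2| + |(p + q) / 2 - p|) ^ 2 := by
  have e : (p + q) / 2 - p = (q - p) / 2 := by ring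
  rw [e]
  rcases le_total 0 p with hp | hp <;> rcases le_total 0 (p + q) with h1 | h1 <;>
    rcases le_total 0 (q - p) with h2 | h2
  all_goals first
    | (rw [abs_of_nonneg hp]) | (rw [abs_of_nonpos hp])
  all_goals first
    | (rw [abs_of_nonneg (by linarith : 0 ≤ (p + q) / 2)]) | (rw [abs_of_nonpos (by linarith : (p + q) / 2 ≤ 0)])
  all_goals first
    | (rw [abs_of_nonneg (by linarith : 0 ≤ (q - p) / 2)]) | (rw [abs_of_nonpos (by linarith : (q - p) / 2 ≤ 0)])
  all_goals nlinarith

open scoped Classical in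
/-- **The rising in-plane slots of a normal-form frame carry `√3 · sin θ`.**  See the module docstring. -/
theorem sum_inPlane_rising_ge (L : EuclideanSpace ℝ (Fin 3) ≃ₗᵢ[ℝ] EuclideanSpace ℝ (Fin 3))
    (F : Bool → (EuclideanSpace ℝ (Fin 3) ≃ₗᵢ[ℝ] EuclideanSpace ℝ (Fin 3)))
    (hF : (F false = L ∧ F true = (ℝ ∙ EuclideanSpace.single (2 : Fin 3) (1 : ℝ)).reflection.trans L) ∨
      (F false = (ℝ ∙ EuclideanSpace.single (2 : Fin 3) (1 : ℝ)).reflection.trans L ∧ F true = L))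
    {n : EuclideanSpace ℝ (Fin 3)}
    (hn : n = L (EuclideanSpace.single (2 : Fin 3) (1 : ℝ)) ∨ n = -L (EuclideanSpace.single (2 : Fin 3) (1 : ℝ))) :
    Real.sqrt 3 * Real.sqrt (1 - ⟪L (EuclideanSpace.single (2 : Fin 3) (1 : ℝ)),
        (EuclideanSpace.single (2 : Fin 3) (1 : ℝ))⟫_ℝ ^ 2) ≤
      ∑ r ∈ fccSlots.filter (fun r => ⟪F false r, n⟫_ℝ = 0 ∧ 0 < (F false r) 2), (F false r) 2 := by
  set RT := fccSlots.filter (fun r => ⟪F false r, n⟫_ℝ = 0 ∧ 0 < (F false r) 2) with hRT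
  -- the model in-plane basis `u₁, u₂, u₂ − u₁`: slots of height zero
  have hax : ∀ w, ⟪F false w, L (EuclideanSpace.single (2 : Fin 3) (1 : ℝ))⟫_ℝ = w 2 := by
    intro w
    rcases hF with ⟨h0, -⟩ | ⟨h0, -⟩ <;> rw [h0]
    · exact inner_frame_axis L w
    · exact inner_twinFrame_axis L w
  have hinp : ∀ w : EuclideanSpace ℝ (Fin 3), w 2 = 0 → ⟪F false w, n⟫_ℝ = 0 := by
    intro w hw
    rcases hn with h' | h'
    · rw [h', hax, hw]
    · rw [h', inner_neg_right, hax, hw, neg_zero]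
  -- `F false` agrees with `L` on in-plane model vectors up to sign (`R w = -w` there)
  have he₃1 : ‖(EuclideanSpace.single (2 : Fin 3) (1 : ℝ) : EuclideanSpace ℝ (Fin 3))‖ = 1 := by
    rw [PiLp.norm_single, norm_one]
  have hFL : ∀ w : EuclideanSpace ℝ (Fin 3), w 2 = 0 → F false w = L w ∨ F false w = -L w := by
    intro w hw
    rcases hF with ⟨h0, -⟩ | ⟨h0, -⟩ <;> rw [h0]
    · exact Or.inl rfl
    · right
      rw [LinearIsometryEquiv.trans_apply, halfTurn_apply, hw, mul_zero, zero_smul, zero_sub, map_neg]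
  have habs : ∀ w : EuclideanSpace ℝ (Fin 3), w 2 = 0 → |(F false w) 2| = |(L w) 2| := by
    intro w hw
    rcases hFL w hw with h | h
    · rw [h]
    · rw [h, PiLp.neg_apply, abs_neg]
  -- the three in-plane generators
  set u₁ : EuclideanSpace ℝ (Fin 3) := Literature.MathematicalPhysics.StatisticalMechanics.triangularVec₁ 1 with hu₁
  set u₂ : EuclideanSpace ℝ (Fin 3) := Literature.MathematicalPhysics.StatisticalMechanics.triangularVec₂ 1 with hu₂
  obtain ⟨hu₁S, hu₂S, hu₃S⟩ := inPlane_mem_fccSlots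
  obtain ⟨h₁3, h₂3⟩ := inner_triangularVec_e₃
  have hz₁ : u₁ 2 = 0 := by rw [apply_two_eq_inner_e₃]; exact h₁3
  have hz₂ : u₂ 2 = 0 := by rw [apply_two_eq_inner_e₃]; exact h₂3
  have hz₃ : (u₂ - u₁) 2 = 0 := by rw [PiLp.sub_apply, hz₁, hz₂, sub_zero]
  -- the tilt coordinates
  set n' : EuclideanSpace ℝ (Fin 3) := L.symm (EuclideanSpace.single (2 : Fin 3) (1 : ℝ)) with hn'
  have hLn' : L n' = EuclideanSpace.single (2 : Fin 3) (1 : ℝ) := by rw [hn', LinearIsometryEquiv.apply_symm_apply]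
  have hn'1 : ‖n'‖ = 1 := by rw [hn', LinearIsometryEquiv.norm_map, he₃1]
  have hxv : ∀ v : EuclideanSpace ℝ (Fin 3), (L v) 2 = ⟪v, n'⟫_ℝ := by
    intro v; rw [apply_two_eq_inner_e₃, ← hLn', LinearIsometryEquiv.inner_map_map]
  obtain ⟨hx₁, hx₂⟩ := inner_triangularVec n'
  have hLe : ⟪L (EuclideanSpace.single (2 : Fin 3) (1 : ℝ)), EuclideanSpace.single (2 : Fin 3) (1 : ℝ)⟫_ℝ = n' 2 := by
    have h1 : ⟪L (EuclideanSpace.single (2 : Fin 3) (1 : ℝ)), L n'⟫_ℝ =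
        ⟪EuclideanSpace.single (2 : Fin 3) (1 : ℝ), n'⟫_ℝ := LinearIsometryEquiv.inner_map_map L _ _
    rw [hLn'] at h1
    rw [h1, EuclideanSpace.inner_single_left]; simp
  have hs2 : 1 - ⟪L (EuclideanSpace.single (2 : Fin 3) (1 : ℝ)), EuclideanSpace.single (2 : Fin 3) (1 : ℝ)⟫_ℝ ^ 2 =
      n' 0 ^ 2 + n' 1 ^ 2 := by rw [hLe]; exact one_sub_sq_apply_two n' hn'1
  -- the values of the three classes
  set p : ℝ := n' 0 with hp
  set q : ℝ := Real.sqrt 3 * n' 1 with hq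
  have h3 : Real.sqrt 3 ^ 2 = 3 := Real.sq_sqrt (by norm_num)
  have hv₁ : (L u₁) 2 = p := by rw [hxv, hu₁, hx₁]
  have hv₂ : (L u₂) 2 = (p + q) / 2 := by rw [hxv, hu₂, hx₂, hp, hq]; ring
  have hv₃ : (L (u₂ - u₁)) 2 = (p + q) / 2 - p := by rw [map_sub, PiLp.sub_apply, hv₁, hv₂]
  -- `√3 · s ≤ T`
  set T : ℝ := |p| + |(p + q) / 2| + |(p + q) / 2 - p| with hT
  have hT0 : 0 ≤ T := by positivity
  have hTsq : 3 * (1 - ⟪L (EuclideanSpace.single (2 : Fin 3) (1 : ℝ)), EuclideanSpace.single (2 : Fin 3) (1 : ℝ)⟫_ℝ ^ 2) ≤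
      T ^ 2 := by
    rw [hs2, hT]
    have := three_sq_add_sq_le_sum_sq p q
    have hq2 : q ^ 2 = 3 * n' 1 ^ 2 := by rw [hq, mul_pow, h3]
    rw [hq2] at this; linarith
  have hsqrt : Real.sqrt 3 * Real.sqrt (1 - ⟪L (EuclideanSpace.single (2 : Fin 3) (1 : ℝ)),
      EuclideanSpace.single (2 : Fin 3) (1 : ℝ)⟫_ℝ ^ 2) ≤ T := by
    rw [← Real.sqrt_mul (by norm_num : (0 : ℝ) ≤ 3), show T = Real.sqrt (T ^ 2) by rw [Real.sqrt_sq hT0]]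
    exact Real.sqrt_le_sqrt hTsq
  refine hsqrt.trans ?_
  -- the rising representative of each class lies in `RT` and carries `|x|`
  have hrep : ∀ v : EuclideanSpace ℝ (Fin 3), v ∈ fccSlots → v 2 = 0 →
      ∃ r ∈ fccSlots, (r = v ∨ r = -v) ∧ ⟪F false r, n⟫_ℝ = 0 ∧ (F false r) 2 = |(L v) 2| := by
    intro v hv hv0
    have hvn0 : (-v) 2 = 0 := by rw [PiLp.neg_apply, hv0, neg_zero]
    by_cases hsg : 0 ≤ (F false v) 2
    · exact ⟨v, hv, Or.inl rfl, hinp v hv0, by rw [← habs v hv0, abs_of_nonneg hsg]⟩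
    · refine ⟨-v, neg_mem_fccSlots hv, Or.inr rfl, hinp (-v) hvn0, ?_⟩
      rw [map_neg, PiLp.neg_apply, ← habs v hv0, abs_of_neg (not_le.1 hsg)]
  obtain ⟨r₁, hr₁S, hr₁v, hr₁n, hr₁x⟩ := hrep u₁ hu₁S hz₁
  obtain ⟨r₂, hr₂S, hr₂v, hr₂n, hr₂x⟩ := hrep u₂ hu₂S hz₂
  obtain ⟨r₃, hr₃S, hr₃v, hr₃n, hr₃x⟩ := hrep (u₂ - u₁) hu₃S hz₃
  -- pairwise distinct (inner products `±½` against `±1`)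
  obtain ⟨nu₁, nu₂, nu₁₂⟩ := norm_triangularVec_one
  have i12 : ⟪u₁, u₂⟫_ℝ = 1 / 2 := by
    have h := @norm_sub_sq_real _ _ _ u₂ u₁
    rw [nu₁₂, nu₁, nu₂, real_inner_comm] at h; linarith
  have i13 : ⟪u₁, u₂ - u₁⟫_ℝ = -(1 / 2) := by
    rw [inner_sub_right, i12, real_inner_self_eq_norm_sq, nu₁]; norm_num
  have i23 : ⟪u₂, u₂ - u₁⟫_ℝ = 1 / 2 := by
    rw [inner_sub_right, real_inner_comm u₁ u₂, i12, real_inner_self_eq_norm_sq, nu₂]; norm_num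
  have hdist : ∀ a b : EuclideanSpace ℝ (Fin 3), (⟪a, b⟫_ℝ = 1 / 2 ∨ ⟪a, b⟫_ℝ = -(1 / 2)) → ‖b‖ = 1 →
      ∀ r r' : EuclideanSpace ℝ (Fin 3), (r = a ∨ r = -a) → (r' = b ∨ r' = -b) → r ≠ r' := by
    intro a b hab hb r r' hr hr' h
    have key : ⟪r, b⟫_ℝ = ⟪r', b⟫_ℝ := by rw [h]
    have hbb : ⟪b, b⟫_ℝ = 1 := by rw [real_inner_self_eq_norm_sq, hb, one_pow]
    rcases hr with rfl | rfl <;> rcases hr' with rfl | rfl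
    · rw [hbb] at key; rcases hab with hab | hab <;> linarith
    · rw [inner_neg_left, hbb] at key; rcases hab with hab | hab <;> linarith
    · rw [inner_neg_left, hbb] at key; rcases hab with hab | hab <;> linarith
    · rw [inner_neg_left, inner_neg_left, hbb] at key; rcases hab with hab | hab <;> linarith
  have hne12 : r₁ ≠ r₂ := hdist u₁ u₂ (Or.inl i12) nu₂ r₁ r₂ hr₁v hr₂v
  have hne13 : r₁ ≠ r₃ := hdist u₁ (u₂ - u₁) (Or.inr i13) nu₁₂ r₁ r₃ hr₁v hr₃v
  have hne23 : r₂ ≠ r₃ := hdist u₂ (u₂ - u₁) (Or.inl i23) nu₁₂ r₂ r₃ hr₂v hr₃v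
  -- the sub-sum over the rising representatives
  set A : Finset (EuclideanSpace ℝ (Fin 3)) := ({r₁, r₂, r₃} : Finset _).filter fun r => 0 < (F false r) 2 with hA
  have hAsub : A ⊆ RT := by
    intro r hr
    obtain ⟨hr', hpos⟩ := mem_filter.1 hr
    rw [hRT, mem_filter]
    simp only [mem_insert, mem_singleton] at hr'
    rcases hr' with rfl | rfl | rfl
    · exact ⟨hr₁S, hr₁n, hpos⟩
    · exact ⟨hr₂S, hr₂n, hpos⟩
    · exact ⟨hr₃S, hr₃n, hpos⟩
  have hAsum : ∑ r ∈ A, (F false r) 2 = T := by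
    rw [hA, sum_filter, sum_insert (by simp [hne12, hne13]), sum_insert (by simp [hne23]), sum_singleton,
      hr₁x, hr₂x, hr₃x, hv₁, hv₂, hv₃, hT]
    have e : ∀ y : ℝ, (if 0 < |y| then |y| else 0) = |y| := by
      intro y
      by_cases h : 0 < |y|
      · rw [if_pos h]
      · rw [if_neg h]; have := abs_nonneg y; linarith
    rw [e, e, e]; ring
  rw [← hAsum]
  exact sum_le_sum_of_subset_of_nonneg hAsub fun r hr _ => (mem_filter.1 hr).2.2.le

open scoped Classical in
/-- **The CENSUS-FREE MULTI-ROOT in-plane rung of `stub_coaxialTwoSlabAdhesion`** (general fillings, all twin pairs, no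
residual, constant `√6/156`; `KissingGap δ`, `KissingClassification δ` BY NAME).  See the module docstring. -/
theorem coaxialTwoSlabAdhesion_general_twin_multi {δ : ℝ} (hg : KissingGap δ) (hc : KissingClassification δ)
    (A₁ : EuclideanSpace ℝ (Fin 3) ≃ₗᵢ[ℝ] EuclideanSpace ℝ (Fin 3)) (t₁ : EuclideanSpace ℝ (Fin 3))
    (A₂ : EuclideanSpace ℝ (Fin 3) ≃ₗᵢ[ℝ] EuclideanSpace ℝ (Fin 3)) (t₂ : EuclideanSpace ℝ (Fin 3))
    (L : EuclideanSpace ℝ (Fin 3) ≃ₗᵢ[ℝ] EuclideanSpace ℝ (Fin 3)) (s₁ s₂ : EuclideanSpace ℝ (Fin 3))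
    (σ σ' : ℤ → ℤ) (hσ : IsHaggSeq σ) (hσ' : IsHaggSeq σ')
    (hsub₁ : (fun p => A₁ p + t₁) '' fccStacking 1 (Real.sqrt (2 / 3)) ⊆
      (fun p => L p + s₁) '' barlowStacking 1 (Real.sqrt (2 / 3)) σ)
    (hsub₂ : (fun p => A₂ p + t₂) '' fccStacking 1 (Real.sqrt (2 / 3)) ⊆
      (fun p => L p + s₂) '' barlowStacking 1 (Real.sqrt (2 / 3)) σ')
    (htwin : A₁ '' fccStacking 1 (Real.sqrt (2 / 3)) ≠ A₂ '' fccStacking 1 (Real.sqrt (2 / 3))) :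
    ∃ C R₀ : ℝ, 1 ≤ R₀ ∧ ∀ h : ℝ, 0 ≤ h → ∀ ρ : ℝ, R₀ ≤ ρ →
      ∀ X P₁ P₂ : Finset (EuclideanSpace ℝ (Fin 3)),
      (∀ p ∈ X, ∀ q ∈ X, p ≠ q → 1 ≤ dist p q) → P₁ ⊆ X → P₂ ⊆ X \ P₁ →
      (∀ p ∈ X, -(2 * R₀) ≤ p 2 ∧ p 2 ≤ h + 2 * R₀ ∧ p 0 ^ 2 + p 1 ^ 2 ≤ ρ ^ 2) →
      (∀ p, p ∈ P₁ ↔ (p ∈ (fun q => A₁ q + t₁) '' fccStacking 1 (Real.sqrt (2 / 3)) ∧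
        -(2 * R₀) ≤ p 2 ∧ p 2 ≤ -R₀ ∧ p 0 ^ 2 + p 1 ^ 2 ≤ ρ ^ 2)) →
      (∀ p, p ∈ P₂ ↔ (p ∈ (fun q => A₂ q + t₂) '' fccStacking 1 (Real.sqrt (2 / 3)) ∧
        h + R₀ ≤ p 2 ∧ p 2 ≤ h + 2 * R₀ ∧ p 0 ^ 2 + p 1 ^ 2 ≤ ρ ^ 2)) →
      ((((P₁ ×ˢ (X \ P₁)).filter fun pq => dist pq.1 pq.2 = 1).card : ℕ) : ℝ) +
        ((((P₂ ×ˢ ((X \ P₁) \ P₂)).filter fun pq => dist pq.1 pq.2 = 1).card : ℕ) : ℝ) ≤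
        contactDeficiency ((X \ P₁) \ P₂) +
          (Real.sqrt 2 / 4 * ∑ᶠ w ∈ {w ∈ fccStacking 1 (Real.sqrt (2 / 3)) | ‖w‖ = 1},
              |⟪w, A₁.symm (EuclideanSpace.single (2 : Fin 3) (1 : ℝ))⟫_ℝ| +
            Real.sqrt 2 / 4 * ∑ᶠ w ∈ {w ∈ fccStacking 1 (Real.sqrt (2 / 3)) | ‖w‖ = 1},
              |⟪w, A₂.symm (EuclideanSpace.single (2 : Fin 3) (1 : ℝ))⟫_ℝ| -
            (Real.sqrt 6 / 156 : ℝ) * Real.sqrt (1 - ⟪L (EuclideanSpace.single (2 : Fin 3) (1 : ℝ)),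
              (EuclideanSpace.single (2 : Fin 3) (1 : ℝ))⟫_ℝ ^ 2)) * Real.pi * ρ ^ 2 +
          C * (1 + h) * ρ := by
  set e₃ : EuclideanSpace ℝ (Fin 3) := EuclideanSpace.single (2 : Fin 3) (1 : ℝ) with he₃
  set RL : EuclideanSpace ℝ (Fin 3) ≃ₗᵢ[ℝ] EuclideanSpace ℝ (Fin 3) :=
    (ℝ ∙ EuclideanSpace.single (2 : Fin 3) (1 : ℝ)).reflection.trans L with hRL
  have hr : 0 < Real.sqrt (2 / 3) := Real.sqrt_pos.2 (by norm_num)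
  have he₃1 : ‖e₃‖ = 1 := by rw [he₃, PiLp.norm_single, norm_one]
  obtain ⟨C₁, hC₁⟩ := affineSampleDeficit_upper A₁ t₁ 10 (by norm_num)
  obtain ⟨C₂, hC₂⟩ := affineSampleDeficit_upper A₂ t₂ 10 (by norm_num)
  -- the pair is a twin pair in the frame: `σ 0 ≠ σ' 0`
  have htw : σ 0 ≠ σ' 0 := by
    intro heq
    obtain ⟨-, e₁⟩ := linear_image_eq_frame_of_subset A₁ L t₁ s₁ hσ hsub₁
    obtain ⟨-, e₂⟩ := linear_image_eq_frame_of_subset A₂ L t₂ s₂ hσ' hsub₂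
    exact htwin (by rw [e₁, e₂, heq])
  -- normal form: the grains are `F false·Λ₀ + s₁`, `F true·Λ₀ + s₂` with `{F false, F true} = {L, L∘R}`
  have hnorm : ∃ F : Bool → (EuclideanSpace ℝ (Fin 3) ≃ₗᵢ[ℝ] EuclideanSpace ℝ (Fin 3)),
      ((F false = L ∧ F true = RL) ∨ (F false = RL ∧ F true = L)) ∧
      (fun q => A₁ q + t₁) '' fccStacking 1 (Real.sqrt (2 / 3)) =
        (fun q => F false q + s₁) '' fccStacking 1 (Real.sqrt (2 / 3)) ∧
      (fun q => A₂ q + t₂) '' fccStacking 1 (Real.sqrt (2 / 3)) =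
        (fun q => F true q + s₂) '' fccStacking 1 (Real.sqrt (2 / 3)) := by
    rcases hσ 0 with h1 | hm1
    · have hm1' : σ' 0 = -1 := (hσ' 0).resolve_left fun h' => htw (h1.trans h'.symm)
      have e₁ := coaxial_frame_eq_fcc_of_one A₁ t₁ L s₁ hσ hsub₁ h1
      obtain ⟨e₂, -⟩ := coaxial_frame_eq_fcc_of_neg_one A₂ t₂ L s₂ hσ' hsub₂ hm1'
      exact ⟨fun c => cond c RL L, Or.inl ⟨rfl, rfl⟩, e₁, e₂⟩
    · have h1' : σ' 0 = 1 := (hσ' 0).resolve_right fun h' => htw (hm1.trans h'.symm)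
      obtain ⟨e₁, -⟩ := coaxial_frame_eq_fcc_of_neg_one A₁ t₁ L s₁ hσ hsub₁ hm1
      have e₂ := coaxial_frame_eq_fcc_of_one A₂ t₂ L s₂ hσ' hsub₂ h1'
      exact ⟨fun c => cond c L RL, Or.inr ⟨rfl, rfl⟩, e₁, e₂⟩
  obtain ⟨F, hF, e₁, e₂⟩ := hnorm
  -- the axis `n = L e₃`
  obtain ⟨n, hn⟩ : ∃ n : EuclideanSpace ℝ (Fin 3), n = L e₃ ∨ n = -L e₃ := ⟨L e₃, Or.inl rfl⟩
  -- the three rising in-plane classes of the bottom frame carry `√3 sin θ`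
  set s : ℝ := Real.sqrt (1 - ⟪L e₃, e₃⟫_ℝ ^ 2) with hs
  have hs0 : 0 ≤ s := Real.sqrt_nonneg _
  have h63 : Real.sqrt 6 * s ≤
      Real.sqrt 2 * ∑ r ∈ fccSlots.filter (fun r => ⟪F false r, n⟫_ℝ = 0 ∧ 0 < (F false r) 2), (F false r) 2 := by
    have key := sum_inPlane_rising_ge L F hF hn
    have e : Real.sqrt 6 = Real.sqrt 2 * Real.sqrt 3 := by
      rw [← Real.sqrt_mul (by norm_num : (0:ℝ) ≤ 2)]; norm_num
    rw [e, mul_assoc]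
    exact mul_le_mul_of_nonneg_left key (Real.sqrt_nonneg _)
  -- the constant
  have hCE0 : (0 : ℝ) ≤ 12 * Real.sqrt 2 * Real.pi + 36 * 10 + 55440 := by positivity
  refine ⟨|C₁| + |C₂| + (240 * Real.sqrt 2 * Real.pi + 3120 * (4 * 10 + 2)) / 2 +
    12 * (12 * Real.sqrt 2 * Real.pi + 36 * 10 + 55440) / 156, 10, by norm_num, ?_⟩
  intro h hh ρ hρ X P₁ P₂ hX hP₁X hP₂X₁ hcyl hP₁ hP₂
  set φ₁ : ℝ := Real.sqrt 2 / 4 * ∑ᶠ w ∈ {w ∈ fccStacking 1 (Real.sqrt (2 / 3)) | ‖w‖ = 1},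
      |⟪w, A₁.symm e₃⟫_ℝ| with hφ₁
  set φ₂ : ℝ := Real.sqrt 2 / 4 * ∑ᶠ w ∈ {w ∈ fccStacking 1 (Real.sqrt (2 / 3)) | ‖w‖ = 1},
      |⟪w, A₂.symm e₃⟫_ℝ| with hφ₂
  have hP₂X : P₂ ⊆ X := hP₂X₁.trans sdiff_subset
  have hρ0 : (0 : ℝ) ≤ ρ := by linarith
  -- (1) the two slab samples from above
  have hD₁ := hC₁ (-(2 * 10)) (-10) (by norm_num) ρ hρ P₁ hP₁
  have hD₂ := hC₂ (h + 10) (h + 2 * 10) (by ring) ρ hρ P₂ hP₂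
  -- (2) the interior ledger
  have hled := ledger_ge_faces_add_interior A₁ t₁ A₂ t₂ X P₁ P₂ 10 h ρ le_rfl hh hρ hX hcyl hP₁X hP₂X
    hP₁ hP₂
  have hf₁ : Real.sqrt 2 / 4 * ∑ w ∈ fccSlots, |⟪A₁ w, e₃⟫_ℝ| = φ₁ := by
    rw [hφ₁, finsum_unit_fcc_symm_eq_sum_slots]
  have hf₂ : Real.sqrt 2 / 4 * ∑ w ∈ fccSlots, |⟪A₂ w, e₃⟫_ℝ| = φ₂ := by
    rw [hφ₂, finsum_unit_fcc_symm_eq_sum_slots]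
  rw [hf₁, hf₂, ← two_mul_contactDeficiency_eq_sum X] at hled
  -- (3) the payers of the interior window, fed by the in-plane lines (if they rise)
  have hP₁' := hP₁
  have hP₂' := hP₂
  simp only [e₁, e₂] at hP₁' hP₂'
  have hpay : Real.sqrt 6 * s * Real.pi * ρ ^ 2 - 12 * (12 * Real.sqrt 2 * Real.pi + 36 * 10 + 55440) * ρ ≤
      78 * ((X.filter fun z => (X.filter fun q => dist z q = 1).card ≤ 11 ∧
        -10 - 2 ≤ z 2 ∧ z 2 ≤ h + 10 + 2).card : ℝ) := by
    have hcellpay := wordNet_twin_payers_ge_multi hg hc L F hF hn s₁ s₂ X P₁ P₂ 10 h ρ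
      le_rfl hh hρ hX hcyl hP₁X hP₂X hP₁' hP₂'
    have hπρ : 0 ≤ Real.pi * ρ ^ 2 := by positivity
    have hflux' : Real.sqrt 6 * s * Real.pi * ρ ^ 2 ≤
        Real.sqrt 2 * (∑ r ∈ fccSlots.filter (fun r => ⟪F false r, n⟫_ℝ = 0 ∧ 0 < (F false r) 2), (F false r) 2) *
          Real.pi * ρ ^ 2 := by
      have := mul_le_mul_of_nonneg_right h63 hπρ
      simp only [mul_assoc] at this ⊢
      exact this
    refine le_trans ?_ hcellpay
    linarith only [hflux']
  have hPAY : ((X.filter fun z => (X.filter fun q => dist z q = 1).card ≤ 11 ∧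
        -10 - 2 ≤ z 2 ∧ z 2 ≤ h + 10 + 2).card : ℝ) ≤
      ((X.filter fun y => (X.filter fun q => dist y q = 1).card ≠ 12 ∧
        -10 - 2 ≤ y 2 ∧ y 2 ≤ h + 10 + 2).card : ℝ) := by
    exact_mod_cast card_le_card fun z hz => by
      rw [mem_filter] at hz ⊢
      exact ⟨hz.1, by have := hz.2.1; omega, hz.2.2⟩
  -- (5) the two splits of the skeleton
  have hs₁ := contactDeficiency_sdiff_split hP₁X
  have hs₂ := contactDeficiency_sdiff_split hP₂X₁
  -- (6) assemble
  have ha : C₁ * ρ ≤ |C₁| * (1 + h) * ρ := by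
    have h1 : C₁ * ρ ≤ |C₁| * ρ := mul_le_mul_of_nonneg_right (le_abs_self _) hρ0
    have h2 : 0 ≤ |C₁| * h * ρ := by positivity
    linarith only [h1, h2]
  have hb : C₂ * ρ ≤ |C₂| * (1 + h) * ρ := by
    have h1 : C₂ * ρ ≤ |C₂| * ρ := mul_le_mul_of_nonneg_right (le_abs_self _) hρ0
    have h2 : 0 ≤ |C₂| * h * ρ := by positivity
    linarith only [h1, h2]
  have hCE : 12 * (12 * Real.sqrt 2 * Real.pi + 36 * 10 + 55440) * ρ ≤
      12 * (12 * Real.sqrt 2 * Real.pi + 36 * 10 + 55440) * (1 + h) * ρ := by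
    have := mul_nonneg (mul_nonneg hCE0 hh) hρ0
    nlinarith only [this]
  -- name the four counts
  set PAY : Finset (EuclideanSpace ℝ (Fin 3)) := X.filter fun z => (X.filter fun q => dist z q = 1).card ≤ 11 ∧
    -10 - 2 ≤ z 2 ∧ z 2 ≤ h + 10 + 2
  set PAY' : Finset (EuclideanSpace ℝ (Fin 3)) := X.filter fun y => (X.filter fun q => dist y q = 1).card ≠ 12 ∧
    -10 - 2 ≤ y 2 ∧ y 2 ≤ h + 10 + 2
  have t1 : ((((P₁ ×ˢ (X \ P₁)).filter fun pq => dist pq.1 pq.2 = 1).card : ℕ) : ℝ) +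
      ((((P₂ ×ˢ ((X \ P₁) \ P₂)).filter fun pq => dist pq.1 pq.2 = 1).card : ℕ) : ℝ) =
      contactDeficiency P₁ + contactDeficiency P₂ + contactDeficiency ((X \ P₁) \ P₂) -
        contactDeficiency X := by linarith only [hs₁, hs₂]
  have t2 : Real.sqrt 6 * s * Real.pi * ρ ^ 2 - 12 * (12 * Real.sqrt 2 * Real.pi + 36 * 10 + 55440) * ρ ≤
      78 * (PAY'.card : ℝ) := by
    linarith only [hpay, hPAY]
  have t3 : 2 * φ₁ * Real.pi * ρ ^ 2 + 2 * φ₂ * Real.pi * ρ ^ 2 + (PAY'.card : ℝ) -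
      (240 * Real.sqrt 2 * Real.pi + 3120 * (4 * 10 + 2)) * (1 + h) * ρ ≤ 2 * contactDeficiency X := by
    linarith only [hled]
  have t4 : contactDeficiency P₁ ≤ 2 * φ₁ * Real.pi * ρ ^ 2 + C₁ * ρ := hD₁
  have t5 : contactDeficiency P₂ ≤ 2 * φ₂ * Real.pi * ρ ^ 2 + C₂ * ρ := hD₂
  linarith only [t1, t2, t3, t4, t5, ha, hb, hCE]

end Summit.Ventures.Crystal3D.Theorems

end
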